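import Literature.NumberTheory.ZetaValues.TaurasoBivariateWZPair
import Literature.NumberTheory.ZetaValues.WZSummation
import HarnessLib

/-!
# Tauraso's bivariate generating function of `ζ(2+r+2s)` (proof of the named fact `tauraso2020_bivariate`)

Topic `Literature/NumberTheory/ZetaValues`; proofs-only companion of `AperyLikeGeneratingFunctions.lean`, discharging
`tauraso2020_bivariate` [Tauraso2020, (2)]: for complex `a, b` with `|a| + |b|² < 1`,
`Σ_{k≥1} 1/(k² − ak − b²) = Σ_{k≥1} ((3k−a)/(k C(2k,k))) ∏_{j<k}(j² − a² − 4b²)/∏_{j≤k}(j² − aj − b²)`.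

Proof: the WZ pair `(F, G)` of `TaurasoBivariateWZPair.lean` (`tauraso_wz`, `tauraso_F_zero`, `tauraso_G_zero`) is
summed by `wz_tsum_eq_tsum` (`WZSummation.lean`): `Σ_k F(0,k) = Σ_n G(n,0)` is the identity. Boundary terms
(private, this file): with `ρ = |a| + |b|² < 1`, `Q(m) = m² − am − b²`, `S(m) = m² − a² − 4b²`,
`|Q(m)| ≥ m(m − ρ)`, so `∏_{i=0}^{n} |Q(k+1+i)| ≥ (1−ρ)(k+1)² (n+1)! n!` (the factor `i = 0` carries `(k+1)(k+1−ρ) ≥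
(1−ρ)(k+1)²`, the others `(k+1+i)(k+1+i−ρ) ≥ (i+1) i`); `|S(m)| ≤ m²(1 + 5/m²)`, `∏(1 + 5/m²) ≤ e^{10}`, so
`|κ_n| ≤ e^{10} n!⁴/(2n)!`; with `(n+1) n!² ≤ (2n)!` this gives `|F(n,k)| ≤ K/((n+1)²(k+1)²)` and
`|G(n,k)| ≤ 2K/((n+1)²(k+1))`, `K = e^{10}/(1−ρ)`. Both series of (GF2) are summable
(`tauraso_summable_lhs`, `tauraso_summable_rhs`).
-/

open Finset Filter Topology

noncomputable section

namespace Literature.NumberTheory.ZetaValues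

/-- `Σ_{m<n} 1/(m+1)² ≤ 2`. [folklore] -/
private theorem harm_two_le' (n : ℕ) : ∑ m ∈ range n, 1 / ((m : ℝ) + 1) ^ 2 ≤ 2 := by
  have h : ∀ n : ℕ, ∑ m ∈ range (n + 1), 1 / ((m : ℝ) + 1) ^ 2 ≤ 2 - 1 / ((n : ℝ) + 1) := by
    intro n
    induction n with
    | zero => norm_num
    | succ n ih =>
      rw [sum_range_succ]
      push_cast
      have h1 : 1 / (((n : ℝ) + 1 + 1) ^ 2) ≤ 1 / ((n : ℝ) + 1) - 1 / ((n : ℝ) + 1 + 1) := by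
        rw [div_sub_div _ _ (by positivity) (by positivity), div_le_div_iff₀ (by positivity) (by positivity)]
        nlinarith [(n.cast_nonneg : (0 : ℝ) ≤ n)]
      linarith
  calc ∑ m ∈ range n, 1 / ((m : ℝ) + 1) ^ 2 ≤ ∑ m ∈ range (n + 1), 1 / ((m : ℝ) + 1) ^ 2 :=
        sum_le_sum_of_subset_of_nonneg (Finset.range_mono (Nat.le_succ n)) fun m _ _ => by positivity
    _ ≤ 2 := (h n).trans (by linarith [(by positivity : (0 : ℝ) < 1 / ((n : ℝ) + 1))])

/-- `(n+1) n!² ≤ (2n)!` (i.e. `C(2n,n) ≥ n+1`). [folklore] -/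
private theorem succ_mul_factorial_sq_le (n : ℕ) : (n + 1) * n.factorial ^ 2 ≤ (2 * n).factorial := by
  induction n with
  | zero => simp
  | succ n ih =>
    rw [show 2 * (n + 1) = 2 * n + 1 + 1 by ring, Nat.factorial_succ (2 * n + 1), Nat.factorial_succ (2 * n),
      Nat.factorial_succ n]
    calc (n + 1 + 1) * ((n + 1) * n.factorial) ^ 2 = (n + 2) * (n + 1) * ((n + 1) * n.factorial ^ 2) := by ring
      _ ≤ (2 * n + 1 + 1) * (2 * n + 1) * ((n + 1) * n.factorial ^ 2) :=
          Nat.mul_le_mul_right _ (Nat.mul_le_mul (by omega) (by omega))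
      _ ≤ (2 * n + 1 + 1) * (2 * n + 1) * (2 * n).factorial := Nat.mul_le_mul_left _ ih
      _ = (2 * n + 1 + 1) * ((2 * n + 1) * (2 * n).factorial) := by ring

/-- The kernel's denominator: `‖(∏_{i≤n} Q(k+1+i))⁻¹‖ ≤ 1/((1−ρ)(k+1)²(n+1)! n!)`. [folklore] -/
private theorem norm_qprod_inv_le {a b : ℂ} (hab : ‖a‖ + ‖b‖ ^ 2 < 1) (n k : ℕ) :
    ‖(∏ i ∈ range (n + 1), (((k : ℂ) + 1 + i) ^ 2 - a * ((k : ℂ) + 1 + i) - b ^ 2))⁻¹‖ ≤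
      1 / ((1 - (‖a‖ + ‖b‖ ^ 2)) * ((k : ℝ) + 1) ^ 2 * ((n + 1).factorial : ℝ) * (n.factorial : ℝ)) := by
  set ρ : ℝ := ‖a‖ + ‖b‖ ^ 2 with hρ
  have hρ0 : 0 ≤ ρ := by positivity
  have hk : (0 : ℝ) ≤ k := k.cast_nonneg
  -- each factor
  have hfac : ∀ i : ℕ, ((k : ℝ) + 1 + i) * (((k : ℝ) + 1 + i) - ρ) ≤
      ‖(((k : ℂ) + 1 + i) ^ 2 - a * ((k : ℂ) + 1 + i) - b ^ 2)‖ := by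
    intro i
    have hx : (1 : ℝ) ≤ (k : ℝ) + 1 + i := by linarith [(i.cast_nonneg : (0 : ℝ) ≤ i)]
    have h := tauraso_norm_Q_ge a b hx
    have e : ((((k : ℝ) + 1 + i : ℝ)) : ℂ) = (k : ℂ) + 1 + i := by push_cast; ring
    rwa [e] at h
  -- the product from `i = 1` on dominates `(n+1)! n!`, the factor `i = 0` carries `(1−ρ)(k+1)²`
  have hlow : (1 - ρ) * ((k : ℝ) + 1) ^ 2 * ((n + 1).factorial : ℝ) * (n.factorial : ℝ) ≤
      ∏ i ∈ range (n + 1), (((k : ℝ) + 1 + i) * (((k : ℝ) + 1 + i) - ρ)) := by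
    rw [prod_range_succ']
    push_cast
    simp only [add_zero]
    have h0 : (1 - ρ) * ((k : ℝ) + 1) ^ 2 ≤ ((k : ℝ) + 1) * (((k : ℝ) + 1) - ρ) := by
      nlinarith [mul_nonneg (mul_nonneg hρ0 hk) (show (0 : ℝ) ≤ (k : ℝ) + 1 by positivity)]
    have h1 : ((n + 1).factorial : ℝ) * (n.factorial : ℝ) ≤
        ∏ i ∈ range n, (((k : ℝ) + 1 + ((i : ℝ) + 1)) * (((k : ℝ) + 1 + ((i : ℝ) + 1)) - ρ)) := by
      have e1 : ((n + 1).factorial : ℝ) = ∏ i ∈ range n, ((i : ℝ) + 2) := by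
        have h := Finset.prod_range_add_one_eq_factorial (n + 1)
        rw [prod_range_succ'] at h
        have h' : ((∏ i ∈ range n, (i + 1 + 1)) * (0 + 1) : ℕ) = (n + 1).factorial := h
        simp only [zero_add, mul_one] at h'
        rw [← h']; push_cast; exact prod_congr rfl fun i _ => by ring
      have e2 : (n.factorial : ℝ) = ∏ i ∈ range n, ((i : ℝ) + 1) := by
        rw [← Finset.prod_range_add_one_eq_factorial]; push_cast; rfl
      rw [e1, e2, ← prod_mul_distrib]
      refine prod_le_prod (fun i _ => by positivity) fun i _ => ?_
      have hi : (0 : ℝ) ≤ i := i.cast_nonneg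
      nlinarith [mul_nonneg hk hi]
    calc (1 - ρ) * ((k : ℝ) + 1) ^ 2 * ((n + 1).factorial : ℝ) * (n.factorial : ℝ)
        = ((1 - ρ) * ((k : ℝ) + 1) ^ 2) * (((n + 1).factorial : ℝ) * (n.factorial : ℝ)) := by ring
      _ ≤ (((k : ℝ) + 1) * (((k : ℝ) + 1) - ρ)) *
          ∏ i ∈ range n, (((k : ℝ) + 1 + ((i : ℝ) + 1)) * (((k : ℝ) + 1 + ((i : ℝ) + 1)) - ρ)) :=
          mul_le_mul h0 h1 (by positivity) (by nlinarith)
      _ = _ := by rw [mul_comm]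
  have hpos : 0 < (1 - ρ) * ((k : ℝ) + 1) ^ 2 * ((n + 1).factorial : ℝ) * (n.factorial : ℝ) := by
    have : 0 < 1 - ρ := by linarith
    positivity
  have hprod : (1 - ρ) * ((k : ℝ) + 1) ^ 2 * ((n + 1).factorial : ℝ) * (n.factorial : ℝ) ≤
      ‖(∏ i ∈ range (n + 1), (((k : ℂ) + 1 + i) ^ 2 - a * ((k : ℂ) + 1 + i) - b ^ 2))‖ := by
    rw [norm_prod]
    refine hlow.trans (prod_le_prod (fun i _ => ?_) fun i _ => hfac i)
    have hx : (1 : ℝ) ≤ (k : ℝ) + 1 + i := by linarith [(i.cast_nonneg : (0 : ℝ) ≤ i)]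
    exact mul_nonneg (by linarith) (by linarith)
  rw [norm_inv, one_div]
  exact inv_anti₀ hpos hprod

/-- The kernel's numerator: `‖κ_n‖ ≤ e^{10} n!⁴/(2n)!`. [folklore] -/
private theorem norm_kap_le {a b : ℂ} (hab : ‖a‖ + ‖b‖ ^ 2 < 1) (n : ℕ) :
    ‖((n.factorial : ℂ) ^ 2 / ((2 * n).factorial : ℂ) *
        ∏ j ∈ range n, (((j : ℂ) + 1) ^ 2 - a ^ 2 - 4 * b ^ 2))‖ ≤
      Real.exp 10 * ((n.factorial : ℝ) ^ 4 / ((2 * n).factorial : ℝ)) := by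
  have ha : ‖a‖ ^ 2 ≤ 1 := by nlinarith [norm_nonneg a, norm_nonneg b, pow_nonneg (norm_nonneg b) 2]
  have hb : ‖b‖ ^ 2 ≤ 1 := by nlinarith [norm_nonneg a, norm_nonneg b]
  have hS : ∀ j : ℕ, ‖(((j : ℂ) + 1) ^ 2 - a ^ 2 - 4 * b ^ 2)‖ ≤ ((j : ℝ) + 1) ^ 2 * (1 + 5 / ((j : ℝ) + 1) ^ 2) := by
    intro j
    have e2 : ‖((j : ℂ) + 1) ^ 2‖ = ((j : ℝ) + 1) ^ 2 := by
      rw [show ((j : ℂ) + 1) = ((j + 1 : ℕ) : ℂ) by push_cast; ring, norm_pow, Complex.norm_natCast]; push_cast; ring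
    have h1 : ‖(((j : ℂ) + 1) ^ 2 - a ^ 2 - 4 * b ^ 2)‖ ≤ ((j : ℝ) + 1) ^ 2 + (‖a‖ ^ 2 + 4 * ‖b‖ ^ 2) := by
      rw [sub_sub]
      refine (norm_sub_le _ _).trans ?_
      rw [e2]
      gcongr
      refine (norm_add_le _ _).trans ?_
      rw [norm_pow, norm_mul, norm_pow, show ‖(4 : ℂ)‖ = 4 by norm_num]
    have hj : ((j : ℝ) + 1) ≠ 0 := by positivity
    rw [show ((j : ℝ) + 1) ^ 2 * (1 + 5 / ((j : ℝ) + 1) ^ 2) = ((j : ℝ) + 1) ^ 2 + 5 by field_simp]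
    linarith
  have hexp : ∏ j ∈ range n, (1 + 5 / ((j : ℝ) + 1) ^ 2) ≤ Real.exp 10 := by
    calc ∏ j ∈ range n, (1 + 5 / ((j : ℝ) + 1) ^ 2) ≤ ∏ j ∈ range n, Real.exp (5 / ((j : ℝ) + 1) ^ 2) :=
          prod_le_prod (fun j _ => by positivity) fun j _ => by rw [add_comm]; exact Real.add_one_le_exp _
      _ = Real.exp (∑ j ∈ range n, 5 / ((j : ℝ) + 1) ^ 2) := (Real.exp_sum _ _).symm
      _ ≤ Real.exp 10 := by
          refine Real.exp_le_exp.2 ?_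
          calc ∑ j ∈ range n, 5 / ((j : ℝ) + 1) ^ 2 = 5 * ∑ j ∈ range n, 1 / ((j : ℝ) + 1) ^ 2 := by
                rw [mul_sum]; exact sum_congr rfl fun j _ => by ring
            _ ≤ 5 * 2 := by gcongr; exact harm_two_le' n
            _ = 10 := by norm_num
  have efac : ∏ j ∈ range n, ((j : ℝ) + 1) ^ 2 = (n.factorial : ℝ) ^ 2 := by
    rw [prod_pow, ← Finset.prod_range_add_one_eq_factorial]; push_cast; rfl
  rw [norm_mul, norm_div, norm_pow, Complex.norm_natCast, Complex.norm_natCast, norm_prod]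
  calc (n.factorial : ℝ) ^ 2 / ((2 * n).factorial : ℝ) * ∏ j ∈ range n, ‖(((j : ℂ) + 1) ^ 2 - a ^ 2 - 4 * b ^ 2)‖
      ≤ (n.factorial : ℝ) ^ 2 / ((2 * n).factorial : ℝ) * ∏ j ∈ range n, (((j : ℝ) + 1) ^ 2 * (1 + 5 / ((j : ℝ) + 1) ^ 2)) := by
        gcongr with j hj
        exact hS j
    _ = (n.factorial : ℝ) ^ 2 / ((2 * n).factorial : ℝ) * (n.factorial : ℝ) ^ 2 *
          ∏ j ∈ range n, (1 + 5 / ((j : ℝ) + 1) ^ 2) := by rw [prod_mul_distrib, efac]; ring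
    _ ≤ (n.factorial : ℝ) ^ 2 / ((2 * n).factorial : ℝ) * (n.factorial : ℝ) ^ 2 * Real.exp 10 := by gcongr
    _ = Real.exp 10 * ((n.factorial : ℝ) ^ 4 / ((2 * n).factorial : ℝ)) := by ring

/-- The analytic hypotheses of `wz_tsum_eq_tsum` for the pair of `TaurasoBivariateWZPair.lean`: with
`K = e^{10}/(1−ρ)`, `‖F(n,k)‖ ≤ K/((n+1)²(k+1)²)` and `‖G(n,k)‖ ≤ 2K/((n+1)²(k+1))`. [folklore] -/
private theorem tauraso_pair_facts {a b : ℂ} (hab : ‖a‖ + ‖b‖ ^ 2 < 1) :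
    let F : ℕ → ℕ → ℂ := fun n k =>
      ((n.factorial : ℂ) ^ 2 / ((2 * n).factorial : ℂ) *
        ∏ j ∈ range n, (((j : ℂ) + 1) ^ 2 - a ^ 2 - 4 * b ^ 2)) *
        (∏ i ∈ range (n + 1), (((k : ℂ) + 1 + i) ^ 2 - a * ((k : ℂ) + 1 + i) - b ^ 2))⁻¹
    let G : ℕ → ℕ → ℂ := fun n k =>
      ((n.factorial : ℂ) ^ 2 / ((2 * n).factorial : ℂ) *
        ∏ j ∈ range n, (((j : ℂ) + 1) ^ 2 - a ^ 2 - 4 * b ^ 2)) *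
        ((2 * (k : ℂ) + 3 * n + 3 - a) / (2 * (2 * (n : ℂ) + 1))) *
        (∏ i ∈ range (n + 1), (((k : ℂ) + 1 + i) ^ 2 - a * ((k : ℂ) + 1 + i) - b ^ 2))⁻¹
    (∀ n, Summable (F n)) ∧ (∀ n, Tendsto (G n) atTop (𝓝 0)) ∧
      Tendsto (fun n => ∑' k, F n k) atTop (𝓝 0) ∧ Summable (fun n => G n 0) := by
  intro F G
  have hρ1 : 0 < 1 - (‖a‖ + ‖b‖ ^ 2) := by linarith
  have ha1 : ‖a‖ ≤ 1 := by nlinarith [norm_nonneg a, pow_nonneg (norm_nonneg b) 2]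
  set K : ℝ := Real.exp 10 / (1 - (‖a‖ + ‖b‖ ^ 2)) with hK
  have hK0 : 0 ≤ K := by positivity
  have hS2 : Summable fun k : ℕ => 1 / ((k : ℝ) + 1) ^ 2 := by
    simpa using (summable_nat_add_iff 1).2 (Real.summable_one_div_nat_pow.2 one_lt_two)
  have hS1 : Tendsto (fun k : ℕ => 1 / ((k : ℝ) + 1)) atTop (𝓝 0) := tendsto_one_div_add_atTop_nhds_zero_nat
  -- the bound on `F`
  have hFb : ∀ n k : ℕ, ‖F n k‖ ≤ K * (1 / ((n : ℝ) + 1) ^ 2) * (1 / ((k : ℝ) + 1) ^ 2) := by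
    intro n k
    have h2n : ((n : ℝ) + 1) * (n.factorial : ℝ) ^ 2 ≤ ((2 * n).factorial : ℝ) := by
      exact_mod_cast succ_mul_factorial_sq_le n
    have efac : ((n + 1).factorial : ℝ) = ((n : ℝ) + 1) * (n.factorial : ℝ) := by
      rw [Nat.factorial_succ]; push_cast; ring
    simp only [F]
    rw [norm_mul]
    calc ‖((n.factorial : ℂ) ^ 2 / ((2 * n).factorial : ℂ) *
        ∏ j ∈ range n, (((j : ℂ) + 1) ^ 2 - a ^ 2 - 4 * b ^ 2))‖ *
          ‖(∏ i ∈ range (n + 1), (((k : ℂ) + 1 + i) ^ 2 - a * ((k : ℂ) + 1 + i) - b ^ 2))⁻¹‖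
        ≤ (Real.exp 10 * ((n.factorial : ℝ) ^ 4 / ((2 * n).factorial : ℝ))) *
            (1 / ((1 - (‖a‖ + ‖b‖ ^ 2)) * ((k : ℝ) + 1) ^ 2 * ((n + 1).factorial : ℝ) * (n.factorial : ℝ))) :=
          mul_le_mul (norm_kap_le hab n) (norm_qprod_inv_le hab n k) (norm_nonneg _) (by positivity)
      _ = K * ((n.factorial : ℝ) ^ 2 / (((2 * n).factorial : ℝ) * ((n : ℝ) + 1))) * (1 / ((k : ℝ) + 1) ^ 2) := by
          rw [hK, efac]; field_simp
      _ ≤ K * (1 / ((n : ℝ) + 1) ^ 2) * (1 / ((k : ℝ) + 1) ^ 2) := by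
          apply mul_le_mul_of_nonneg_right _ (by positivity)
          apply mul_le_mul_of_nonneg_left _ hK0
          rw [div_le_div_iff₀ (by positivity) (by positivity)]
          nlinarith [h2n, (by positivity : (0 : ℝ) ≤ (n : ℝ) + 1)]
  -- the bound on `G`
  have hGb : ∀ n k : ℕ, ‖G n k‖ ≤ 2 * K * (1 / ((n : ℝ) + 1) ^ 2) * (1 / ((k : ℝ) + 1)) := by
    intro n k
    have hn : (0 : ℝ) ≤ n := n.cast_nonneg
    have hk : (0 : ℝ) ≤ k := k.cast_nonneg
    have hq : ‖(2 * (k : ℂ) + 3 * n + 3 - a) / (2 * (2 * (n : ℂ) + 1))‖ ≤ 2 * ((k : ℝ) + 1) := by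
      have e1 : ‖(2 * (2 * (n : ℂ) + 1))‖ = 2 * (2 * (n : ℝ) + 1) := by
        rw [show (2 * (2 * (n : ℂ) + 1)) = ((2 * (2 * n + 1) : ℕ) : ℂ) by push_cast; ring, Complex.norm_natCast]
        push_cast; ring
      have e2 : ‖(2 * (k : ℂ) + 3 * n + 3 - a)‖ ≤ 2 * (k : ℝ) + 3 * n + 3 + 1 := by
        refine (norm_sub_le _ _).trans ?_
        rw [show (2 * (k : ℂ) + 3 * n + 3) = ((2 * k + 3 * n + 3 : ℕ) : ℂ) by push_cast; ring, Complex.norm_natCast]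
        push_cast; linarith
      rw [norm_div, e1, div_le_iff₀ (by positivity)]
      nlinarith [mul_nonneg hn hk]
    have eG : G n k = F n k * ((2 * (k : ℂ) + 3 * n + 3 - a) / (2 * (2 * (n : ℂ) + 1))) := by
      simp only [F, G]; ring
    rw [eG, norm_mul]
    calc ‖F n k‖ * ‖(2 * (k : ℂ) + 3 * n + 3 - a) / (2 * (2 * (n : ℂ) + 1))‖
        ≤ (K * (1 / ((n : ℝ) + 1) ^ 2) * (1 / ((k : ℝ) + 1) ^ 2)) * (2 * ((k : ℝ) + 1)) :=
          mul_le_mul (hFb n k) hq (norm_nonneg _) (by positivity)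
      _ = 2 * K * (1 / ((n : ℝ) + 1) ^ 2) * (1 / ((k : ℝ) + 1)) := by
          have : ((k : ℝ) + 1) ≠ 0 := by positivity
          field_simp
  refine ⟨fun n => Summable.of_norm_bounded (hS2.mul_left _) (hFb n), fun n => ?_, ?_, ?_⟩
  · refine squeeze_zero_norm (hGb n) ?_
    have h := hS1.const_mul (2 * K * (1 / ((n : ℝ) + 1) ^ 2))
    rw [mul_zero] at h
    exact h
  · have hle : ∀ n : ℕ, ‖∑' k, F n k‖ ≤ K * (1 / ((n : ℝ) + 1) ^ 2) * ∑' k : ℕ, 1 / ((k : ℝ) + 1) ^ 2 :=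
      fun n => tsum_of_norm_bounded (hS2.hasSum.mul_left _) (hFb n)
    refine squeeze_zero_norm hle ?_
    have h := ((hS2.tendsto_atTop_zero).const_mul K).mul_const (∑' k : ℕ, 1 / ((k : ℝ) + 1) ^ 2)
    rw [mul_zero, zero_mul] at h
    exact h
  · refine Summable.of_norm_bounded (hS2.mul_left (2 * K)) fun n => (hGb n 0).trans (le_of_eq ?_)
    simp

/-- The core: both series of (GF2) are summable and the identity holds. [folklore] -/
private theorem tauraso_main {a b : ℂ} (hab : ‖a‖ + ‖b‖ ^ 2 < 1) :
    Summable (fun k : ℕ => 1 / (((k + 1 : ℕ) : ℂ) ^ 2 - a * ((k + 1 : ℕ) : ℂ) - b ^ 2)) ∧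
      Summable (fun k : ℕ => (3 * ((k + 1 : ℕ) : ℂ) - a) / (((k + 1 : ℕ) : ℂ) * ((k + 1).centralBinom : ℂ)) *
        ((∏ j ∈ Finset.Ico 1 (k + 1), ((j : ℂ) ^ 2 - a ^ 2 - 4 * b ^ 2)) /
          ∏ j ∈ Finset.Icc 1 (k + 1), ((j : ℂ) ^ 2 - a * (j : ℂ) - b ^ 2))) ∧
      ∑' k : ℕ, 1 / (((k + 1 : ℕ) : ℂ) ^ 2 - a * ((k + 1 : ℕ) : ℂ) - b ^ 2) =
        ∑' k : ℕ, (3 * ((k + 1 : ℕ) : ℂ) - a) / (((k + 1 : ℕ) : ℂ) * ((k + 1).centralBinom : ℂ)) *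
        ((∏ j ∈ Finset.Ico 1 (k + 1), ((j : ℂ) ^ 2 - a ^ 2 - 4 * b ^ 2)) /
          ∏ j ∈ Finset.Icc 1 (k + 1), ((j : ℂ) ^ 2 - a * (j : ℂ) - b ^ 2)) := by
  have hQ := tauraso_Q_ne_zero hab
  set F : ℕ → ℕ → ℂ := fun n k =>
      ((n.factorial : ℂ) ^ 2 / ((2 * n).factorial : ℂ) *
        ∏ j ∈ range n, (((j : ℂ) + 1) ^ 2 - a ^ 2 - 4 * b ^ 2)) *
        (∏ i ∈ range (n + 1), (((k : ℂ) + 1 + i) ^ 2 - a * ((k : ℂ) + 1 + i) - b ^ 2))⁻¹ with hFdef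
  set G : ℕ → ℕ → ℂ := fun n k =>
      ((n.factorial : ℂ) ^ 2 / ((2 * n).factorial : ℂ) *
        ∏ j ∈ range n, (((j : ℂ) + 1) ^ 2 - a ^ 2 - 4 * b ^ 2)) *
        ((2 * (k : ℂ) + 3 * n + 3 - a) / (2 * (2 * (n : ℂ) + 1))) *
        (∏ i ∈ range (n + 1), (((k : ℂ) + 1 + i) ^ 2 - a * ((k : ℂ) + 1 + i) - b ^ 2))⁻¹ with hGdef
  obtain ⟨hFs, hGt, hFt, hG0⟩ : (∀ n, Summable (F n)) ∧ (∀ n, Tendsto (G n) atTop (𝓝 0)) ∧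
      Tendsto (fun n => ∑' k, F n k) atTop (𝓝 0) ∧ Summable (fun n => G n 0) := tauraso_pair_facts hab
  have hWZ : ∀ n k, F (n + 1) k - F n k = G n (k + 1) - G n k := fun n k => tauraso_wz hQ n k
  have key : ∑' k, F 0 k = ∑' n, G n 0 := wz_tsum_eq_tsum hWZ hFs hGt hFt hG0
  have eF : ∀ k : ℕ, F 0 k = 1 / (((k : ℂ) + 1) ^ 2 - a * ((k : ℂ) + 1) - b ^ 2) := fun k => tauraso_F_zero a b k
  have eG : ∀ n : ℕ, G n 0 = (3 * ((n + 1 : ℕ) : ℂ) - a) / (((n + 1 : ℕ) : ℂ) * ((n + 1).centralBinom : ℂ)) *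
      ((∏ j ∈ Finset.Ico 1 (n + 1), ((j : ℂ) ^ 2 - a ^ 2 - 4 * b ^ 2)) /
        ∏ j ∈ Finset.Icc 1 (n + 1), ((j : ℂ) ^ 2 - a * (j : ℂ) - b ^ 2)) := fun n => tauraso_G_zero a b hQ n
  have eF' : ∀ k : ℕ, 1 / (((k + 1 : ℕ) : ℂ) ^ 2 - a * ((k + 1 : ℕ) : ℂ) - b ^ 2) = F 0 k := fun k => by rw [eF]; push_cast; ring
  exact ⟨(hFs 0).congr fun k => (eF' k).symm, hG0.congr eG, (tsum_congr eF').trans (key.trans (tsum_congr eG))⟩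

/-- The left-hand side of (GF2), `Σ_{k≥1} 1/(k² − ak − b²)`, converges absolutely for `|a| + |b|² < 1`.
[cite: Tauraso2020, §1 (2)] -/
theorem tauraso_summable_lhs {a b : ℂ} (hab : ‖a‖ + ‖b‖ ^ 2 < 1) :
    Summable fun k : ℕ => 1 / (((k + 1 : ℕ) : ℂ) ^ 2 - a * ((k + 1 : ℕ) : ℂ) - b ^ 2) :=
  (tauraso_main hab).1

/-- The right-hand side of (GF2) converges for `|a| + |b|² < 1`. [cite: Tauraso2020, §1 (2)] -/
theorem tauraso_summable_rhs {a b : ℂ} (hab : ‖a‖ + ‖b‖ ^ 2 < 1) :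
    Summable fun k : ℕ => (3 * ((k + 1 : ℕ) : ℂ) - a) / (((k + 1 : ℕ) : ℂ) * ((k + 1).centralBinom : ℂ)) *
        ((∏ j ∈ Finset.Ico 1 (k + 1), ((j : ℂ) ^ 2 - a ^ 2 - 4 * b ^ 2)) /
          ∏ j ∈ Finset.Icc 1 (k + 1), ((j : ℂ) ^ 2 - a * (j : ℂ) - b ^ 2)) :=
  (tauraso_main hab).2.1

/-- **Tauraso 2020, (2) = (GF2)** (discharge of the named fact `tauraso2020_bivariate`): for complex `a, b` with
`|a| + |b|² < 1`, `Σ_{k≥1} 1/(k² − ak − b²) = Σ_{k≥1} ((3k−a)/(k C(2k,k))) ∏_{j<k}(j² − a² − 4b²)/∏_{j≤k}(j² − aj − b²)`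
(the generating function `Σ_{r,s} C(r+s,r) ζ(2+r+2s) aʳ b^{2s}`; `a = 0`: Bailey–Borwein–Bradley 2006), by a direct
Wilf–Zeilberger pair and WZ summation with vanishing boundary terms. [cite: Tauraso2020, §1 (2) and §3]
[cite: HessamiPilehrood2008WZ, §1 Prop. 1, §4] -/
theorem tauraso2020_bivariate_holds : tauraso2020_bivariate := fun _ _ hab => (tauraso_main hab).2.2

end Literature.NumberTheory.ZetaValues
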